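import Summits.Ventures.DiscreteObjects.Hadamard.AutomorphismFixedRows668

/-!
# Hadamard 668 census, family F12 — the fixed submatrix of an order-41 automorphism of H(668) is a Hadamard matrix of order 12 (kernel)

Framing: lottery ticket; floor = certified bounds/negative ranges.

Cell pub-namedobj (venture DiscreteObjects), target (H), hadamard gen 7.  Let `H` be a Hadamard matrix of order `668` and
`(π, κ, d, e)` a signed-permutation automorphism with `π^41 = κ^41 = 1`, `(π, κ) ≠ (1, 1)`.  Gen 6 proved (kernel,
`hadamard668_fixedRows_41`) that `π` fixes exactly `12` rows and `κ` exactly `12` columns.  Here: **the `12 × 12` submatrix of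
`H` on the fixed rows × fixed columns is itself a Hadamard matrix of order `12`** — distinct fixed rows are orthogonal already on
the fixed columns (and hence also on the moved columns), and dually for columns.  Proof (no design theory): for fixed rows
`u ≠ u'` the function `j ↦ H u j * H u' j` takes the values `±1` and satisfies `g (κ j) = d u * d u' * g j`; if `d u * d u' = -1`
then iterating `41` times gives `g j = -g j`, impossible, so `g` is constant along every `κ`-orbit of moved columns, the moved
part of `∑ j, g j = 0` is divisible by `41` (`dvd_sum_moved`), hence so is the fixed part, which has absolute value `≤ 12`.
This is the first identity of the 'Hadamard form' of the orbit matrix (FAMILY-F12-G7 §2: `41·C Cᵀ + F Fᵀ = 668·I` forces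
`F Fᵀ = 12·I`); for `p = 47` resp. `31` the same argument would require a Hadamard matrix of order `10` resp. `17`.
Ours, not literature; no `sorry`; no `decide` beyond the imported files.
-/

open Finset BigOperators Matrix

namespace Summit.Ventures.DiscreteObjects.Hadamard

open Literature.Combinatorics.Designs.GoethalsSeidel (IsHadamardMatrix)

variable {ι : Type*} [Fintype ι] [DecidableEq ι]

omit [Fintype ι] [DecidableEq ι] in
/-- along a `κ`-orbit the product of two fixed rows picks up the factor `d u * d u'` -/
lemma fixedRows_prod_step {H : Matrix ι ι ℤ} {π κ : Equiv.Perm ι} {d e : ι → ℤ} (haut : IsSignedAut H π κ d e)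
    {u u' : ι} (hu : π u = u) (hu' : π u' = u') (j : ι) :
    H u (κ j) * H u' (κ j) = (d u * d u') * (H u j * H u' j) := by
  obtain ⟨-, he, hH⟩ := haut
  have h1 : H u (κ j) = d u * e j * H u j := by rw [← hH u j, hu]
  have h2 : H u' (κ j) = d u' * e j * H u' j := by rw [← hH u' j, hu']
  rw [h1, h2]
  have hee : e j * e j = 1 := pm_mul_self (he j)
  calc d u * e j * H u j * (d u' * e j * H u' j) = (d u * d u') * (e j * e j) * (H u j * H u' j) := by ring
    _ = (d u * d u') * (H u j * H u' j) := by rw [hee, mul_one]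

omit [Fintype ι] [DecidableEq ι] in
/-- iterating: `H u (κ^i j) * H u' (κ^i j) = (d u * d u')^i * (H u j * H u' j)` -/
lemma fixedRows_prod_pow {H : Matrix ι ι ℤ} {π κ : Equiv.Perm ι} {d e : ι → ℤ} (haut : IsSignedAut H π κ d e)
    {u u' : ι} (hu : π u = u) (hu' : π u' = u') (i : ℕ) (j : ι) :
    H u ((κ ^ i) j) * H u' ((κ ^ i) j) = (d u * d u') ^ i * (H u j * H u' j) := by
  induction i generalizing j with
  | zero => simp
  | succ i ih =>
    rw [pow_succ', Equiv.Perm.mul_apply, fixedRows_prod_step haut hu hu', ih, pow_succ]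
    ring

/-- the sign characters of two `π`-fixed rows agree (`d u * d u' = 1`) as soon as `κ` has odd order `41`:
otherwise `41` iterations would negate a `±1` product -/
lemma fixedRows_sign_eq {H : Matrix ι ι ℤ} (hH : IsHadamardMatrix H) {π κ : Equiv.Perm ι} {d e : ι → ℤ}
    (haut : IsSignedAut H π κ d e) (hκ : κ ^ 41 = 1) {u u' : ι} (hu : π u = u) (hu' : π u' = u') (j : ι) :
    d u * d u' = 1 := by
  have hd := haut.1
  have hprod : d u * d u' = 1 ∨ d u * d u' = -1 := by
    rcases hd u with h | h <;> rcases hd u' with h' | h' <;> simp [h, h']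
  rcases hprod with h | h
  · exact h
  · exfalso
    have key := fixedRows_prod_pow haut hu hu' 41 j
    rw [hκ, Equiv.Perm.one_apply, h] at key
    have hne : H u j * H u' j ≠ 0 := mul_ne_zero (pm_ne_zero (hH.1 u j)) (pm_ne_zero (hH.1 u' j))
    have : (H u j * H u' j) * 2 = 0 := by
      have e41 : ((-1 : ℤ)) ^ 41 = -1 := by norm_num
      rw [e41] at key
      linarith
    rcases mul_eq_zero.mp this with h0 | h0
    · exact hne h0
    · norm_num at h0

/-- **Fixed rows are orthogonal on the fixed columns.**  For a Hadamard matrix of order `668` with a signed automorphism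
`(π, κ, d, e)`, `π^41 = κ^41 = 1`, `(π, κ) ≠ (1,1)`, and two distinct `π`-fixed rows `u ≠ u'`:
`∑_{κ j = j} H u j * H u' j = 0` (and hence also `∑_{κ j ≠ j} H u j * H u' j = 0`). -/
theorem hadamard668_fixedRows_orth_41 {H : Matrix ι ι ℤ} (hH : IsHadamardMatrix H) (hι : Fintype.card ι = 668)
    (π κ : Equiv.Perm ι) (d e : ι → ℤ) (haut : IsSignedAut H π κ d e)
    (hπ : π ^ 41 = 1) (hκ : κ ^ 41 = 1) (hne : π ≠ 1 ∨ κ ≠ 1) {u u' : ι} (hu : π u = u) (hu' : π u' = u')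
    (huu' : u ≠ u') :
    ∑ j ∈ univ.filter (fun j => κ j = j), H u j * H u' j = 0 ∧
    ∑ j ∈ univ.filter (fun j => κ j ≠ j), H u j * H u' j = 0 := by
  have hp : (41 : ℕ).Prime := by norm_num
  -- the whole row product vanishes
  have htot : ∑ j, H u j * H u' j = 0 := hadamard_row_orth H hH huu'
  -- split into fixed and moved columns
  have hsplit : ∑ j, H u j * H u' j =
      ∑ j ∈ univ.filter (fun j => κ j = j), H u j * H u' j + ∑ j ∈ univ.filter (fun j => κ j ≠ j), H u j * H u' j := by
    rw [← Finset.sum_filter_add_sum_filter_not univ (fun j => κ j = j)]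
  -- the moved part is divisible by 41
  have hsign : d u * d u' = 1 := by
    obtain ⟨j₀⟩ : Nonempty ι := by
      rw [← Fintype.card_pos_iff, hι]; norm_num
    exact fixedRows_sign_eq hH haut hκ hu hu' j₀
  have hdvd : (41 : ℤ) ∣ ∑ j ∈ univ.filter (fun j => κ j ≠ j), H u j * H u' j := by
    have := dvd_sum_moved κ hp hκ (fun j => H u j * H u' j) (by
      intro y₀ _ i
      have e := fixedRows_prod_pow haut hu hu' i y₀
      rw [hsign, one_pow, one_mul] at e
      exact e)
    exact_mod_cast this
  -- the fixed part has absolute value at most 12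
  have hcount := (hadamard668_fixedRows_41 hH hι π κ d e haut hπ hκ hne).2
  have hbound : |∑ j ∈ univ.filter (fun j => κ j = j), H u j * H u' j| ≤ 12 := by
    calc |∑ j ∈ univ.filter (fun j => κ j = j), H u j * H u' j|
        ≤ ∑ j ∈ univ.filter (fun j => κ j = j), |H u j * H u' j| := Finset.abs_sum_le_sum_abs _ _
      _ = ∑ j ∈ univ.filter (fun j => κ j = j), (1 : ℤ) := by
          apply Finset.sum_congr rfl
          intro j _
          rw [abs_mul]
          have a1 : |H u j| = 1 := by rcases hH.1 u j with h | h <;> simp [h]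
          have a2 : |H u' j| = 1 := by rcases hH.1 u' j with h | h <;> simp [h]
          rw [a1, a2, mul_one]
      _ = 12 := by rw [Finset.sum_const, nsmul_eq_mul, mul_one, hcount]; norm_num
  have hfix_dvd : (41 : ℤ) ∣ ∑ j ∈ univ.filter (fun j => κ j = j), H u j * H u' j := by
    have e : ∑ j ∈ univ.filter (fun j => κ j = j), H u j * H u' j =
        -(∑ j ∈ univ.filter (fun j => κ j ≠ j), H u j * H u' j) := by linarith [hsplit, htot]
    rw [e]; exact (dvd_neg).mpr hdvd
  have hfix : ∑ j ∈ univ.filter (fun j => κ j = j), H u j * H u' j = 0 := by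
    obtain ⟨k, hk⟩ := hfix_dvd
    have h41 : |(41 : ℤ) * k| ≤ 12 := by rw [← hk]; exact hbound
    rw [abs_mul] at h41
    have h41' : (41 : ℤ) * |k| ≤ 12 := by simpa using h41
    have hlt : |k| < 1 := by linarith
    have hk0 : k = 0 := by
      have := abs_lt.mp hlt
      omega
    rw [hk, hk0, mul_zero]
  refine ⟨hfix, ?_⟩
  linarith [hsplit, htot]

/-- **The fixed `12 × 12` submatrix is a Hadamard matrix of order 12** (row form): `12` fixed rows, `12` fixed columns, entries
`±1`, and for fixed rows `u, u'`: `∑_{κ j = j} H u j * H u' j = 12·[u = u']`. -/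
theorem hadamard668_fixedSubmatrix_41 {H : Matrix ι ι ℤ} (hH : IsHadamardMatrix H) (hι : Fintype.card ι = 668)
    (π κ : Equiv.Perm ι) (d e : ι → ℤ) (haut : IsSignedAut H π κ d e)
    (hπ : π ^ 41 = 1) (hκ : κ ^ 41 = 1) (hne : π ≠ 1 ∨ κ ≠ 1) :
    (univ.filter fun i => π i = i).card = 12 ∧ (univ.filter fun j => κ j = j).card = 12 ∧
    ∀ u u' : ι, π u = u → π u' = u' →
      ∑ j ∈ univ.filter (fun j => κ j = j), H u j * H u' j = if u = u' then 12 else 0 := by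
  have hcount := hadamard668_fixedRows_41 hH hι π κ d e haut hπ hκ hne
  refine ⟨hcount.1, hcount.2, ?_⟩
  intro u u' hu hu'
  by_cases huu' : u = u'
  · subst huu'
    rw [if_pos rfl]
    calc ∑ j ∈ univ.filter (fun j => κ j = j), H u j * H u j
        = ∑ j ∈ univ.filter (fun j => κ j = j), (1 : ℤ) := by
          apply Finset.sum_congr rfl
          intro j _
          exact pm_mul_self (hH.1 u j)
      _ = 12 := by rw [Finset.sum_const, nsmul_eq_mul, mul_one, hcount.2]; norm_num
  · rw [if_neg huu']
    exact (hadamard668_fixedRows_orth_41 hH hι π κ d e haut hπ hκ hne hu hu' huu').1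

/-- **Column form** (apply the row form to `Hᵀ` with the automorphism `(κ, π, e, d)`): for fixed columns `v, v'`:
`∑_{π i = i} H i v * H i v' = 12·[v = v']`. -/
theorem hadamard668_fixedSubmatrix_41_cols {H : Matrix ι ι ℤ} (hH : IsHadamardMatrix H) (hι : Fintype.card ι = 668)
    (π κ : Equiv.Perm ι) (d e : ι → ℤ) (haut : IsSignedAut H π κ d e)
    (hπ : π ^ 41 = 1) (hκ : κ ^ 41 = 1) (hne : π ≠ 1 ∨ κ ≠ 1) :
    ∀ v v' : ι, κ v = v → κ v' = v' →
      ∑ i ∈ univ.filter (fun i => π i = i), H i v * H i v' = if v = v' then 12 else 0 := by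
  have hT : IsHadamardMatrix Hᵀ := isHadamard_transpose hH (by rw [hι]; norm_num)
  have hautT : IsSignedAut Hᵀ κ π e d := by
    obtain ⟨hd, he, h⟩ := haut
    refine ⟨he, hd, fun j i => ?_⟩
    rw [Matrix.transpose_apply, Matrix.transpose_apply, h i j]; ring
  have hne' : κ ≠ 1 ∨ π ≠ 1 := hne.symm
  intro v v' hv hv'
  have h := (hadamard668_fixedSubmatrix_41 hT hι κ π e d hautT hκ hπ hne').2.2 v v' hv hv'
  simpa [Matrix.transpose_apply] using h

end Summit.Ventures.DiscreteObjects.Hadamard
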